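import Literature.Computability.Learning.AmpPEvalFP
import Literature.Computability.Learning.ModpTables
import Literature.Computability.Learning.ColumnPredictorFP
import Literature.Computability.Complexity.CodeFPBudgets
import HarnessLib

/-!
# The `AC⁰[p]` learner: the tables of the NW predictor from the answers, in `FP`

Machine-layer groundwork for the named fact `Literature.Computability.Learning.cikk_learn_AC0Mod`
(CIKK 2016, Cor. 5.4): the learner's construction of the TABLES of the NW predictor for the
challenge block `i` (CIKK §2.4, preprocessing step 4; §5, complete algorithm step 2) — for every
block `j` and every pattern number `c`, the value of `AMP_p(f)` on the pattern input
`patInput … i j z c`, computed from the membership-query answers at its `2Tk` points — as a typed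
recipe and a polynomial-time code (no string-level fold plumbing):

* `matchN`, `rankN`, `posN`, `patInputN` (the pattern input from the column program `colValL`
  and the seed bits; `patInputN_eq` identifies it with `ColDesign.patInput` over the learner's
  design `designP`), `numEntriesN`, `ansSegN`, `entryN` (`AmpPEvalFP.ampPValN`), `tableN`,
  `tablesN`;
* `AnswersOKP` (the answer layout: the segment at `((jL + c) · 2Tk)` lists `f` at the points of
  the pattern input) and **`tablesN_getD`**: with correct answers, table `j < i` is
  `ColDesign.tableList (Modp.colVal Q ℓ) (designP …) (ampPFin 𝔭 f k β T) i j z`;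
* `tables_codeFP` (the recipe as a `CodeFP`, output the list code of the tables).

## References

* M. Carmosino, R. Impagliazzo, V. Kabanets, A. Kolokolova, *Learning algorithms from natural
  proofs*, CCC 2016, §2.4 (preprocessing, step 4), §5 (complete algorithm, step 2)
  [CarmosinoImpagliazzoKabanetsKolokolova2016].
* S. Arora, B. Barak, *Computational Complexity: A Modern Approach*, CUP 2009, §1.3 [AroraBarak2009].
-/

open Polynomial

namespace Literature.Computability.Learning

namespace Modp

open Literature.Computability.Complexity Literature.Computability.Complexity.Brick
  Literature.Computability.Complexity.Plumb Literature.Computability.MetaComplexity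
  Literature.Computability.MetaComplexity.GFDesign Literature.Computability.Cryptography _root_.Computability Finset CodeFP

variable [P : PrimeP]

/-! ### The typed recipe -/

/-- The `ℓ` bits of `j`. [folklore] -/
def jbitsN (ℓ j : ℕ) : List Bool := (natE j).takeD ℓ false

/-- Columns `τ` of blocks `ibits` and `j` match. [folklore] -/
def matchN (Q ℓ : ℕ) (ibits : List Bool) (j τ : ℕ) : Bool :=
  decide (colValL 𝔭 Q ℓ ibits τ = colValL 𝔭 Q ℓ (jbitsN ℓ j) τ)

/-- The rank of column `τ`: the matching columns before it. [folklore] -/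
def rankN (Q ℓ : ℕ) (ibits : List Bool) (j τ : ℕ) : ℕ := ((List.range τ).filter fun τ' => matchN Q ℓ ibits j τ').length

/-- The position of the design of block `j` in column `τ`. [folklore] -/
def posN (Q ℓ : ℕ) (j τ : ℕ) : ℕ := colValL 𝔭 Q ℓ (jbitsN ℓ j) τ + Q * τ

/-- **The pattern input** of block `j` under the pattern number `c`: bit `rank τ` of `c` on the
matching columns, the seed elsewhere. [cite: CarmosinoImpagliazzoKabanetsKolokolova2016, §2.4 (preprocessing, step 4)] -/
def patInputN (Q ℓ N : ℕ) (ibits zbits : List Bool) (j c : ℕ) : List Bool :=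
  (List.range N).map fun τ => if matchN Q ℓ ibits j τ then c.testBit (rankN Q ℓ ibits j τ) else zbits.getD (posN Q ℓ j τ) false

/-- The number of entries of table `j`: `min 2^{#matching} L`. [folklore] -/
def numEntriesN (Q ℓ N L : ℕ) (ibits : List Bool) (j : ℕ) : ℕ := min (2 ^ rankN Q ℓ ibits j N) L

/-- The answer segment of entry `(j, c)`: `2Tk` bits at offset `(jL + c) · 2Tk`. [folklore] -/
def ansSegN (L T k : ℕ) (ans : List Bool) (j c : ℕ) : List Bool := (ans.drop ((j * L + c) * (T * 2 * k))).take (T * 2 * k)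

/-- **The entry `(j, c)`**: `AMP_p(f)` of the pattern input from its answers. [cite: CarmosinoImpagliazzoKabanetsKolokolova2016, §5 (step 2)] -/
def entryN (Q ℓ n k β T L : ℕ) (ibits zbits ans : List Bool) (j c : ℕ) : Bool :=
  ampPValN 𝔭 n k β T (patInputN Q ℓ (T * 2 * (k * n + k * β)) ibits zbits j c) (ansSegN L T k ans j c)

/-- Table `j`. [cite: CarmosinoImpagliazzoKabanetsKolokolova2016, §5 (step 2)] -/
def tableN (Q ℓ n k β T L : ℕ) (ibits zbits ans : List Bool) (j : ℕ) : List Bool :=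
  (List.range (numEntriesN Q ℓ (T * 2 * (k * n + k * β)) L ibits j)).map fun c => entryN Q ℓ n k β T L ibits zbits ans j c

/-- **The `L` tables.** [cite: CarmosinoImpagliazzoKabanetsKolokolova2016, §5 (step 2)] -/
def tablesN (Q ℓ n k β T L : ℕ) (ibits zbits ans : List Bool) : List (List Bool) :=
  (List.range L).map fun j => tableN Q ℓ n k β T L ibits zbits ans j

/-! ### The recipe computes the NW tables -/

section Values

variable {t ℓ n k β T : ℕ} (ht : t ≠ 0) (hn : T * 2 * (k * n + k * β) ≤ 𝔭 ^ t) (i : Fin (2 ^ ℓ)) (z : Fin (𝔭 ^ t * 𝔭 ^ t) → Bool)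

omit P in
/-- Reading a padded prefix. [folklore] -/
theorem getD_takeD (l : List Bool) {m r : ℕ} (hr : r < m) : (l.takeD m false).getD r false = l.getD r false := by
  rw [BitFormat.takeD_eq_take_append_replicate, List.getD_eq_getElem?_getD, List.getElem?_take, if_pos hr,
    List.getD_eq_getElem?_getD]
  by_cases h : r < l.length
  · rw [List.getElem?_append_left h]
  · rw [List.getElem?_append_right (not_lt.1 h), List.getElem?_eq_none_iff.2 (not_lt.1 h)]
    by_cases h' : r - l.length < m
    · rw [List.getElem?_replicate, if_pos h']; rfl
    · rw [List.getElem?_eq_none_iff.2 (by simp; omega)]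

omit P in
/-- The bits of `j < 2^ℓ`. [folklore] -/
theorem jbitsN_eq {j : ℕ} (hj : j < 2 ^ ℓ) : jbitsN ℓ j = List.ofFn ((boolFunEquivFin ℓ).symm ⟨j, hj⟩) := by
  rw [← ofFn_testBit_eq hj, jbitsN]
  apply List.ext_getElem
  · simp [List.takeD_length]
  · intro r h1 h2
    rw [List.length_ofFn] at h2
    have h := getD_takeD (natE j) h2
    rw [List.getD_eq_getElem _ _ h1] at h
    rw [h, List.getElem_ofFn, testBit_eq_getD_encodeNat]

/-- `matchN` is the matching indicator `colMatch` of the learner's column design. [folklore] -/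
theorem matchN_eq {j : ℕ} (hj : j < 2 ^ ℓ) (τ : ℕ) :
    matchN (𝔭 ^ t) ℓ (List.ofFn ((boolFunEquivFin ℓ).symm i)) j τ = decide (ColDesign.colMatch (colVal (𝔭 ^ t) ℓ) i ⟨j, hj⟩ τ) := by
  rw [matchN, jbitsN_eq hj]; rfl

/-- `rankN` is the rank `ColDesign.rank`. [folklore] -/
theorem rankN_eq {j : ℕ} (hj : j < 2 ^ ℓ) (τ : ℕ) :
    rankN (𝔭 ^ t) ℓ (List.ofFn ((boolFunEquivFin ℓ).symm i)) j τ = ColDesign.rank (colVal (𝔭 ^ t) ℓ) i ⟨j, hj⟩ τ := by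
  rw [rankN, ColDesign.rank, ← List.toFinset_card_of_nodup ((List.nodup_range).filter _)]
  congr 1
  ext τ'
  simp [matchN_eq i hj]

/-- `rankN` at `n'` is the number of matching columns. [folklore] -/
theorem rankN_top {j : ℕ} (hj : j < 2 ^ ℓ) (n' : ℕ) :
    rankN (𝔭 ^ t) ℓ (List.ofFn ((boolFunEquivFin ℓ).symm i)) j n' = (ColDesign.matching (colVal (𝔭 ^ t) ℓ) n' i ⟨j, hj⟩).card := by
  rw [rankN_eq i hj, ColDesign.rank, ColDesign.matching, ← Finset.card_map Fin.valEmbedding]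
  congr 1
  ext τ
  simp only [Finset.mem_filter, Finset.mem_range, Finset.mem_map, Finset.mem_univ, true_and, Fin.valEmbedding_apply]
  constructor
  · rintro ⟨hτ, hm⟩; exact ⟨⟨τ, hτ⟩, hm, rfl⟩
  · rintro ⟨τ', hm, rfl⟩; exact ⟨τ'.isLt, hm⟩

include ht hn in
/-- The seed bit at the recipe's position is the seed at the design position. [folklore] -/
theorem getD_posN {j : ℕ} (hj : j < 2 ^ ℓ) (τ : Fin (T * 2 * (k * n + k * β))) :
    (List.ofFn z).getD (posN (𝔭 ^ t) ℓ j τ) false = z (designP ht _ ℓ hn ⟨j, hj⟩ τ) := by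
  have hpos : posN (𝔭 ^ t) ℓ j τ = ((designP ht _ ℓ hn ⟨j, hj⟩ τ : Fin (𝔭 ^ t * 𝔭 ^ t)) : ℕ) := by
    rw [designP_val ht hn, posN, jbitsN_eq hj]; rfl
  rw [hpos, List.getD_eq_getElem _ _ (by simp), List.getElem_ofFn]

/-- **The pattern input recipe is `ColDesign.patInput`** over the learner's design.
[cite: CarmosinoImpagliazzoKabanetsKolokolova2016, §2.4 (preprocessing, step 4)] -/
theorem patInputN_eq {j : ℕ} (hj : j < 2 ^ ℓ) (c : ℕ) :
    patInputN (𝔭 ^ t) ℓ (T * 2 * (k * n + k * β)) (List.ofFn ((boolFunEquivFin ℓ).symm i)) (List.ofFn z) j c =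
      List.ofFn (ColDesign.patInput (colVal (𝔭 ^ t) ℓ) (designP ht _ ℓ hn) i ⟨j, hj⟩ z c) := by
  rw [patInputN, map_range_eq_ofFn]
  refine congrArg List.ofFn (funext fun τ => ?_)
  rw [matchN_eq i hj, rankN_eq i hj, ColDesign.patInput, getD_posN ht hn z hj τ]
  by_cases h : ColDesign.colMatch (colVal (𝔭 ^ t) ℓ) i ⟨j, hj⟩ τ
  · rw [decide_eq_true h, if_pos rfl, if_pos h]
  · rw [decide_eq_false h, if_neg Bool.false_ne_true, if_neg h]

include ht hn in
/-- The number of entries of table `j ≠ i` is `2^{#matching}`. [folklore] -/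
theorem numEntriesN_eq {j : ℕ} (hj : j < 2 ^ ℓ) (hij : i ≠ ⟨j, hj⟩) :
    numEntriesN (𝔭 ^ t) ℓ (T * 2 * (k * n + k * β)) (2 ^ ℓ) (List.ofFn ((boolFunEquivFin ℓ).symm i)) j =
      2 ^ (ColDesign.matching (colVal (𝔭 ^ t) ℓ) (T * 2 * (k * n + k * β)) i ⟨j, hj⟩).card := by
  rw [numEntriesN, rankN_top i hj]
  exact min_eq_left (Nat.pow_le_pow_right (by norm_num) (card_matching_le ht hn hij))

/-- The number of entries is at most `L`. [folklore] -/
theorem numEntriesN_le (Q N L : ℕ) (ibits : List Bool) (j : ℕ) : numEntriesN Q ℓ N L ibits j ≤ L := min_le_right _ _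

variable (f : (Fin n → Bool) → Bool)

/-- **The answers of a run are correct**: the segment of entry `(j, c)` lists `f` at the `2Tk` points
of the pattern input, in the order of `ansOf`. [folklore] -/
def AnswersOKP (ans : List Bool) : Prop :=
  ∀ (j c : ℕ) (hj : j < 2 ^ ℓ), c < 2 ^ ℓ →
    ansSegN (2 ^ ℓ) T k ans j c = List.ofFn (ansOf f (ColDesign.patInput (colVal (𝔭 ^ t) ℓ) (designP ht _ ℓ hn) i ⟨j, hj⟩ z c))

variable {ht hn i z f} {ans : List Bool}

/-- **The entry is `AMP_p(f)` on the pattern input** (correct answers, `j, c < 2^ℓ`).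
[cite: CarmosinoImpagliazzoKabanetsKolokolova2016, §5 (step 2)] -/
theorem entryN_eq (hans : AnswersOKP ht hn i z f ans) {j c : ℕ} (hj : j < 2 ^ ℓ) (hc : c < 2 ^ ℓ) :
    entryN (𝔭 ^ t) ℓ n k β T (2 ^ ℓ) (List.ofFn ((boolFunEquivFin ℓ).symm i)) (List.ofFn z) ans j c =
      ampPFin 𝔭 f k β T (ColDesign.patInput (colVal (𝔭 ^ t) ℓ) (designP ht _ ℓ hn) i ⟨j, hj⟩ z c) := by
  rw [entryN, patInputN_eq ht hn i z hj, hans j c hj hc, ampPValN_eq]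

/-- The table of block `j` as the learner builds it. [folklore] -/
noncomputable def learnerTableP (ht : t ≠ 0) (hn : T * 2 * (k * n + k * β) ≤ 𝔭 ^ t) (f : (Fin n → Bool) → Bool) (i j : Fin (2 ^ ℓ))
    (z : Fin (𝔭 ^ t * 𝔭 ^ t) → Bool) : List Bool :=
  List.ofFn fun c : Fin (numEntriesN (𝔭 ^ t) ℓ (T * 2 * (k * n + k * β)) (2 ^ ℓ) (List.ofFn ((boolFunEquivFin ℓ).symm i)) j) =>
    ampPFin 𝔭 f k β T (ColDesign.patInput (colVal (𝔭 ^ t) ℓ) (designP ht _ ℓ hn) i j z c)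

/-- **Table `j` of the recipe is the learner's table** (correct answers). [cite: CarmosinoImpagliazzoKabanetsKolokolova2016, §5 (step 2)] -/
theorem tableN_eq (hans : AnswersOKP ht hn i z f ans) {j : ℕ} (hj : j < 2 ^ ℓ) :
    tableN (𝔭 ^ t) ℓ n k β T (2 ^ ℓ) (List.ofFn ((boolFunEquivFin ℓ).symm i)) (List.ofFn z) ans j = learnerTableP ht hn f i ⟨j, hj⟩ z := by
  rw [tableN, learnerTableP, map_range_eq_ofFn]
  refine congrArg List.ofFn (funext fun c => ?_)
  exact entryN_eq hans hj (lt_of_lt_of_le c.isLt (numEntriesN_le _ _ _ _ _))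

/-- **For `j ≠ i` the learner's table is the NW table `tableList`** of `AMP_p(f)`.
[cite: CarmosinoImpagliazzoKabanetsKolokolova2016, §5 (step 2)] -/
theorem learnerTableP_eq_tableList (ht : t ≠ 0) (hn : T * 2 * (k * n + k * β) ≤ 𝔭 ^ t) (f : (Fin n → Bool) → Bool)
    {i j : Fin (2 ^ ℓ)} (hij : i ≠ j) (z : Fin (𝔭 ^ t * 𝔭 ^ t) → Bool) :
    learnerTableP ht hn f i j z = ColDesign.tableList (colVal (𝔭 ^ t) ℓ) (designP ht _ ℓ hn) (ampPFin 𝔭 f k β T) i j z := by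
  have hE := numEntriesN_eq ht hn i j.isLt (by simpa using hij)
  rw [learnerTableP, ColDesign.tableList]
  exact List.ofFn_congr hE _

/-- **The tables of the recipe** (correct answers). [cite: CarmosinoImpagliazzoKabanetsKolokolova2016, §5 (step 2)] -/
theorem tablesN_eq (hans : AnswersOKP ht hn i z f ans) :
    tablesN (𝔭 ^ t) ℓ n k β T (2 ^ ℓ) (List.ofFn ((boolFunEquivFin ℓ).symm i)) (List.ofFn z) ans =
      List.ofFn fun j : Fin (2 ^ ℓ) => learnerTableP ht hn f i j z := by
  rw [tablesN, map_range_eq_ofFn]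
  exact congrArg List.ofFn (funext fun j => tableN_eq hans j.isLt)

/-- **The learner's tables are the NW tables for the blocks before the challenge block** (the
hypothesis `htbls` of `Modp.predFn_eq_nwPredictor` / `evalPFn_apply`).
[cite: CarmosinoImpagliazzoKabanetsKolokolova2016, §5 (step 2)] -/
theorem tablesN_getD (hans : AnswersOKP ht hn i z f ans) (j : Fin (2 ^ ℓ)) (hji : (j : ℕ) < i) :
    (tablesN (𝔭 ^ t) ℓ n k β T (2 ^ ℓ) (List.ofFn ((boolFunEquivFin ℓ).symm i)) (List.ofFn z) ans).getD j [] =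
      ColDesign.tableList (colVal (𝔭 ^ t) ℓ) (designP ht _ ℓ hn) (ampPFin 𝔭 f k β T) i j z := by
  rw [tablesN_eq hans, List.getD_eq_getElem _ _ (by simp), List.getElem_ofFn, Fin.eta,
    learnerTableP_eq_tableList ht hn f (fun h => by rw [h] at hji; exact lt_irrefl _ hji)]

/-- The tables are not longer than the answers allow: each has at most `2^ℓ` entries. [folklore] -/
theorem length_tableN_le (Q L : ℕ) (ibits zbits ans : List Bool) (j : ℕ) : (tableN Q ℓ n k β T L ibits zbits ans j).length ≤ L := by
  rw [tableN, List.length_map, List.length_range]; exact numEntriesN_le _ _ _ _ _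

end Values

/-! ### The recipe as a polynomial-time code -/

section Codes

/-- The typed argument `⟨⟨1^Q, ⟨1^ℓ, ⟨1ⁿ, ⟨1ᵏ, ⟨1^β, ⟨1ᵀ, 1ᴸ⟩⟩⟩⟩⟩⟩, ⟨ibits, ⟨zbits, ans⟩⟩⟩`. [folklore] -/
abbrev TblArgT : Type := (ℕ × (ℕ × (ℕ × (ℕ × (ℕ × (ℕ × ℕ)))))) × (List Bool × (List Bool × List Bool))

/-- Its code. [folklore] -/
abbrev tblArgE : TblArgT → List Bool :=
  pairE (pairE unE (pairE unE (pairE unE (pairE unE (pairE unE (pairE unE unE)))))) (pairE strE (pairE strE strE))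

omit P in
/-- `jbitsN` is a code. [folklore] -/
theorem jbitsN_codeFP : CodeFP (pairE unE natE) strE (fun q => jbitsN q.1 q.2) :=
  (takeD.comp ((fst _ _).pair (strOfNat.comp (snd _ _)))).congr fun _ => rfl

/-- The mask context `⟨1^Q, ⟨1^ℓ, ⟨ibits, 1ᴺ⟩⟩⟩` (`N` the block length, a bound for the ranks). [folklore] -/
abbrev MskT : Type := ℕ × (ℕ × (List Bool × ℕ))

/-- Its code. [folklore] -/
abbrev mskE : MskT → List Bool := pairE unE (pairE unE (pairE strE unE))

/-- `matchN` is a code on `⟨⟨M, j⟩, τ⟩`. [folklore] -/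
theorem matchN_codeFP : CodeFP (pairE (pairE mskE natE) natE) bitE (fun t => matchN t.1.1.1 t.1.1.2.1 t.1.1.2.2.1 t.1.2 t.2) := by
  let eρ := pairE (pairE mskE natE) natE
  have hQ : CodeFP eρ unE (fun t => t.1.1.1) := (fst _ _).fst'.fst'
  have hℓ : CodeFP eρ unE (fun t => t.1.1.2.1) := (fst _ _).fst'.snd'.fst'
  have hi : CodeFP eρ strE (fun t => t.1.1.2.2.1) := (fst _ _).fst'.snd'.snd'.fst'
  have hj : CodeFP eρ natE (fun t => t.1.2) := (fst _ _).snd'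
  have hτ : CodeFP eρ natE (fun t => t.2) := snd _ _
  have hci : CodeFP eρ natE (fun t => colValL 𝔭 t.1.1.1 t.1.1.2.1 t.1.1.2.2.1 t.2) :=
    (codeFP_colValL.comp (hQ.pair (hℓ.pair (hi.pair hτ)))).congr fun _ => rfl
  have hcj : CodeFP eρ natE (fun t => colValL 𝔭 t.1.1.1 t.1.1.2.1 (jbitsN t.1.1.2.1 t.1.2) t.2) :=
    (codeFP_colValL.comp (hQ.pair (hℓ.pair ((jbitsN_codeFP.comp (hℓ.pair hj)).pair hτ)))).congr fun _ => rfl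
  exact (natEq.comp (hci.pair hcj)).congr fun _ => rfl

/-- The bounded rank `#{τ' < min τ N : match}` is a code on `⟨⟨M, j⟩, τ⟩`. [folklore] -/
theorem rankN_codeFP : CodeFP (pairE (pairE mskE natE) natE) natE
    (fun t => rankN t.1.1.1 t.1.1.2.1 t.1.1.2.2.1 t.1.2 (min t.2 t.1.1.2.2.2)) := by
  let eρ := pairE (pairE mskE natE) natE
  have hpred : CodeFP (pairE eρ natE) bitE (fun s => matchN s.1.1.1.1 s.1.1.1.2.1 s.1.1.1.2.2.1 s.1.1.2 s.2) :=
    (matchN_codeFP.comp ((fst _ _).fst'.pair (snd _ _))).congr fun _ => rfl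
  have hfilt := CodeFP.filter (p := fun s : ((MskT × ℕ) × ℕ) × ℕ => matchN s.1.1.1.1 s.1.1.1.2.1 s.1.1.1.2.2.1 s.1.1.2 s.2) hpred
  have hrange : CodeFP eρ (rawE natE) (fun t => List.range (min t.2 t.1.1.2.2.2)) :=
    (rangeOf.comp ((fst _ _).fst'.snd'.snd'.snd'.pair (snd _ _))).congr fun _ => rfl
  exact ((natLength natE).comp (hfilt.comp ((CodeFP.id _).pair hrange))).congr fun t => by simp only [rankN, id]

/-- Below the bound the bounded rank is the rank. [folklore] -/
theorem rankN_min {Q ℓ N : ℕ} (ibits : List Bool) (j : ℕ) {τ : ℕ} (hτ : τ ≤ N) :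
    rankN Q ℓ ibits j (min τ N) = rankN Q ℓ ibits j τ := by rw [min_eq_left hτ]

/-- **`patInputN` is a code** on `⟨⟨M, zbits⟩, ⟨j, c⟩⟩`. [folklore] -/
theorem patInputN_codeFP : CodeFP (pairE (pairE mskE strE) (pairE natE natE)) strE
    (fun a => patInputN a.1.1.1 a.1.1.2.1 a.1.1.2.2.2 a.1.1.2.2.1 a.1.2 a.2.1 a.2.2) := by
  let α := (MskT × List Bool) × (ℕ × ℕ)
  let eα : α → List Bool := pairE (pairE mskE strE) (pairE natE natE)
  let eι := pairE eα natE
  have hA : CodeFP eι eα (fun t => t.1) := fst _ _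
  have hM : CodeFP eι mskE (fun t => t.1.1.1) := hA.fst'.fst'
  have hz : CodeFP eι strE (fun t => t.1.1.2) := hA.fst'.snd'
  have hj : CodeFP eι natE (fun t => t.1.2.1) := hA.snd'.fst'
  have hc : CodeFP eι natE (fun t => t.1.2.2) := hA.snd'.snd'
  have hτ : CodeFP eι natE (fun t => t.2) := snd _ _
  have hmatch : CodeFP eι bitE (fun t => matchN t.1.1.1.1 t.1.1.1.2.1 t.1.1.1.2.2.1 t.1.2.1 t.2) :=
    (matchN_codeFP.comp ((hM.pair hj).pair hτ)).congr fun _ => rfl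
  have hrank : CodeFP eι natE (fun t => rankN t.1.1.1.1 t.1.1.1.2.1 t.1.1.1.2.2.1 t.1.2.1 (min t.2 t.1.1.1.2.2.2)) :=
    (rankN_codeFP.comp ((hM.pair hj).pair hτ)).congr fun _ => rfl
  have hbit1 : CodeFP eι bitE (fun t => t.1.2.2.testBit (rankN t.1.1.1.1 t.1.1.1.2.1 t.1.1.1.2.2.1 t.1.2.1 (min t.2 t.1.1.1.2.2.2))) :=
    (strGetDNat.comp ((strOfNat.comp hc).pair hrank)).congr fun _ => (testBit_eq_getD_encodeNat _ _).symm
  have hQn : CodeFP eι natE (fun t => t.1.1.1.1) := (natOfUn.comp hM.fst').congr fun _ => rfl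
  have hpos : CodeFP eι natE (fun t => posN t.1.1.1.1 t.1.1.1.2.1 t.1.2.1 t.2) :=
    (natAdd.comp ((codeFP_colValL.comp (hM.fst'.pair (hM.snd'.fst'.pair ((jbitsN_codeFP.comp (hM.snd'.fst'.pair hj)).pair hτ)))).pair
      (natMul.comp (hQn.pair hτ)))).congr fun _ => rfl
  have hbit2 : CodeFP eι bitE (fun t => t.1.1.2.getD (posN t.1.1.1.1 t.1.1.1.2.1 t.1.2.1 t.2) false) := (strGetDNat.comp (hz.pair hpos)).congr fun _ => rfl
  have hitem : CodeFP eι bitE (fun t => if matchN t.1.1.1.1 t.1.1.1.2.1 t.1.1.1.2.2.1 t.1.2.1 t.2 then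
      t.1.2.2.testBit (rankN t.1.1.1.1 t.1.1.1.2.1 t.1.1.1.2.2.1 t.1.2.1 (min t.2 t.1.1.1.2.2.2)) else
      t.1.1.2.getD (posN t.1.1.1.1 t.1.1.1.2.1 t.1.2.1 t.2) false) := hmatch.ite hbit1 hbit2
  have hrange : CodeFP eα (rawE natE) (fun a => List.range a.1.1.2.2.2) := (urange.comp (fst _ _).fst'.snd'.snd'.snd').congr fun _ => rfl
  have hmap := (CodeFP.map hitem).comp ((CodeFP.id _).pair hrange)
  refine (bitsToStr.comp hmap).congr fun a => ?_
  simp only [id, patInputN]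
  refine List.map_congr_left fun τ hτ => ?_
  rw [List.mem_range] at hτ
  rw [rankN_min _ _ hτ.le]

/-- The header of the amplifier parameters as a typed tuple. [folklore] -/
abbrev hdrOf (a : TblArgT) : ℕ × (ℕ × (ℕ × ℕ)) := (a.1.2.2.1, (a.1.2.2.2.1, (a.1.2.2.2.2.1, a.1.2.2.2.2.2.1)))

omit P in
/-- The block length `N = 2T(kn + kβ)` in unary. [folklore] -/
theorem blockLen_codeFP : CodeFP tblArgE unE (fun a => a.1.2.2.2.2.2.1 * 2 * (a.1.2.2.2.1 * a.1.2.2.1 + a.1.2.2.2.1 * a.1.2.2.2.2.1)) := by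
  have hn : CodeFP tblArgE unE (fun a => a.1.2.2.1) := (fst _ _).snd'.snd'.fst'
  have hk : CodeFP tblArgE unE (fun a => a.1.2.2.2.1) := (fst _ _).snd'.snd'.snd'.fst'
  have hβ : CodeFP tblArgE unE (fun a => a.1.2.2.2.2.1) := (fst _ _).snd'.snd'.snd'.snd'.fst'
  have hT : CodeFP tblArgE unE (fun a => a.1.2.2.2.2.2.1) := (fst _ _).snd'.snd'.snd'.snd'.snd'.fst'
  exact (unMul.comp ((unMul.comp (hT.pair (const _ 2))).pair (unAdd.comp ((unMul.comp (hk.pair hn)).pair (unMul.comp (hk.pair hβ)))))).congr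
    fun _ => rfl

omit P in
/-- The mask context of the argument. [folklore] -/
theorem mskOf_codeFP : CodeFP tblArgE mskE (fun a => (a.1.1, (a.1.2.1, (a.2.1, a.1.2.2.2.2.2.1 * 2 * (a.1.2.2.2.1 * a.1.2.2.1 + a.1.2.2.2.1 * a.1.2.2.2.2.1))))) :=
  ((fst _ _).fst'.pair ((fst _ _).snd'.fst'.pair ((snd _ _).fst'.pair blockLen_codeFP))).congr fun _ => rfl

/-- **`entryN` is a code** on `⟨⟨a, j⟩, c⟩`. [cite: AroraBarak2009, §1.3] -/
theorem entryN_codeFP : CodeFP (pairE (pairE tblArgE natE) natE) bitE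
    (fun t => entryN t.1.1.1.1 t.1.1.1.2.1 t.1.1.1.2.2.1 t.1.1.1.2.2.2.1 t.1.1.1.2.2.2.2.1 t.1.1.1.2.2.2.2.2.1 t.1.1.1.2.2.2.2.2.2
      t.1.1.2.1 t.1.1.2.2.1 t.1.1.2.2.2 t.1.2 t.2) := by
  let eτ := pairE (pairE tblArgE natE) natE
  have hA : CodeFP eτ tblArgE (fun t => t.1.1) := (fst _ _).fst'
  have hj : CodeFP eτ natE (fun t => t.1.2) := (fst _ _).snd'
  have hc : CodeFP eτ natE (fun t => t.2) := snd _ _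
  have hpat : CodeFP eτ strE (fun t => patInputN t.1.1.1.1 t.1.1.1.2.1
      (t.1.1.1.2.2.2.2.2.1 * 2 * (t.1.1.1.2.2.2.1 * t.1.1.1.2.2.1 + t.1.1.1.2.2.2.1 * t.1.1.1.2.2.2.2.1)) t.1.1.2.1 t.1.1.2.2.1 t.1.2 t.2) :=
    (patInputN_codeFP.comp (((mskOf_codeFP.comp hA).pair (hA.snd'.snd'.fst')).pair (hj.pair hc))).congr fun _ => rfl
  -- the answer segment
  have hL : CodeFP eτ natE (fun t => t.1.1.1.2.2.2.2.2.2) := (natOfUn.comp hA.fst'.snd'.snd'.snd'.snd'.snd'.snd').congr fun _ => rfl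
  have hkq : CodeFP eτ unE (fun t => t.1.1.1.2.2.2.2.2.1 * 2 * t.1.1.1.2.2.2.1) :=
    (unMul.comp ((unMul.comp (hA.fst'.snd'.snd'.snd'.snd'.snd'.fst'.pair (const _ 2))).pair hA.fst'.snd'.snd'.snd'.fst')).congr fun _ => rfl
  have hans : CodeFP eτ strE (fun t => t.1.1.2.2.2) := hA.snd'.snd'.snd'
  have hoffN : CodeFP eτ natE (fun t => (t.1.2 * t.1.1.1.2.2.2.2.2.2 + t.2) * (t.1.1.1.2.2.2.2.2.1 * 2 * t.1.1.1.2.2.2.1)) :=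
    (natMul.comp ((natAdd.comp ((natMul.comp (hj.pair hL)).pair hc)).pair (natOfUn.comp hkq))).congr fun _ => rfl
  have hoff : CodeFP eτ unE (fun t => min ((t.1.2 * t.1.1.1.2.2.2.2.2.2 + t.2) * (t.1.1.1.2.2.2.2.2.1 * 2 * t.1.1.1.2.2.2.1)) t.1.1.2.2.2.length) :=
    (unOfNatMin.comp ((strLength.comp hans).pair hoffN)).congr fun _ => rfl
  have hseg : CodeFP eτ strE (fun t => ansSegN t.1.1.1.2.2.2.2.2.2 t.1.1.1.2.2.2.2.2.1 t.1.1.1.2.2.2.1 t.1.1.2.2.2 t.1.2 t.2) :=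
    (strTake.comp (hkq.pair (strDrop.comp (hoff.pair hans)))).congr fun t => by
      show List.take _ (List.drop (min _ _) _) = List.take _ (List.drop _ _)
      congr 1
      by_cases h : (t.1.2 * t.1.1.1.2.2.2.2.2.2 + t.2) * (t.1.1.1.2.2.2.2.2.1 * 2 * t.1.1.1.2.2.2.1) ≤ t.1.1.2.2.2.length
      · rw [min_eq_left h]
      · rw [min_eq_right (le_of_not_ge h), List.drop_length, List.drop_eq_nil_of_le (le_of_not_ge h)]
  have hhdr : CodeFP eτ (pairE unE (pairE unE (pairE unE unE))) (fun t => hdrOf t.1.1) :=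
    (hA.fst'.snd'.snd'.fst'.pair (hA.fst'.snd'.snd'.snd'.fst'.pair (hA.fst'.snd'.snd'.snd'.snd'.fst'.pair hA.fst'.snd'.snd'.snd'.snd'.snd'.fst'))).congr
      fun _ => rfl
  exact ((ampPVal_codeFP 𝔭).comp (hhdr.pair (hpat.pair hseg))).congr fun _ => rfl

/-- **`tablesN` is a code**, the tables as the list code of strings. [cite: AroraBarak2009, §1.3] -/
theorem tables_codeFP : CodeFP tblArgE (rawE strE)
    (fun a => tablesN a.1.1 a.1.2.1 a.1.2.2.1 a.1.2.2.2.1 a.1.2.2.2.2.1 a.1.2.2.2.2.2.1 a.1.2.2.2.2.2.2 a.2.1 a.2.2.1 a.2.2.2) := by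
  -- table `j`: context `⟨a, j⟩`, item `c`
  have hbits := bitsToStr.comp (CodeFP.map entryN_codeFP)
  -- the number of entries, in unary (bounded by `L`)
  have hA : CodeFP (pairE tblArgE natE) tblArgE (fun s => s.1) := fst _ _
  have hj : CodeFP (pairE tblArgE natE) natE (fun s => s.2) := snd _ _
  have hN : CodeFP (pairE tblArgE natE) unE (fun s => s.1.1.2.2.2.2.2.1 * 2 * (s.1.1.2.2.2.1 * s.1.1.2.2.1 + s.1.1.2.2.2.1 * s.1.1.2.2.2.2.1)) :=
    (blockLen_codeFP.comp hA).congr fun _ => rfl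
  have hrankTop : CodeFP (pairE tblArgE natE) natE (fun s => rankN s.1.1.1 s.1.1.2.1 s.1.2.1 s.2
      (min (s.1.1.2.2.2.2.2.1 * 2 * (s.1.1.2.2.2.1 * s.1.1.2.2.1 + s.1.1.2.2.2.1 * s.1.1.2.2.2.2.1))
        (s.1.1.2.2.2.2.2.1 * 2 * (s.1.1.2.2.2.1 * s.1.1.2.2.1 + s.1.1.2.2.2.1 * s.1.1.2.2.2.2.1)))) :=
    (rankN_codeFP.comp (((mskOf_codeFP.comp hA).pair hj).pair (natOfUn.comp hN))).congr fun _ => rfl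
  have hcountN : CodeFP (pairE tblArgE natE) natE (fun s => numEntriesN s.1.1.1 s.1.1.2.1
      (s.1.1.2.2.2.2.2.1 * 2 * (s.1.1.2.2.2.1 * s.1.1.2.2.1 + s.1.1.2.2.2.1 * s.1.1.2.2.2.2.1)) s.1.1.2.2.2.2.2.2 s.1.2.1 s.2) :=
    (natMin.comp ((natPow.comp ((const _ 2).pair (unOfNatMin.comp (hN.pair hrankTop)))).pair (natOfUn.comp hA.fst'.snd'.snd'.snd'.snd'.snd'.snd'))).congr
      fun s => by
        simp only [numEntriesN, min_self]
        congr 2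
        exact min_eq_left ((List.length_filter_le _ _).trans_eq List.length_range)
  have hcountU : CodeFP (pairE tblArgE natE) unE (fun s => numEntriesN s.1.1.1 s.1.1.2.1
      (s.1.1.2.2.2.2.2.1 * 2 * (s.1.1.2.2.2.1 * s.1.1.2.2.1 + s.1.1.2.2.2.1 * s.1.1.2.2.2.2.1)) s.1.1.2.2.2.2.2.2 s.1.2.1 s.2) :=
    (unOfNatMin.comp (hA.fst'.snd'.snd'.snd'.snd'.snd'.snd'.pair hcountN)).congr fun _ => min_eq_left (numEntriesN_le _ _ _ _ _)
  have htable : CodeFP (pairE tblArgE natE) strE (fun s => tableN s.1.1.1 s.1.1.2.1 s.1.1.2.2.1 s.1.1.2.2.2.1 s.1.1.2.2.2.2.1 s.1.1.2.2.2.2.2.1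
      s.1.1.2.2.2.2.2.2 s.1.2.1 s.1.2.2.1 s.1.2.2.2 s.2) :=
    (hbits.comp ((CodeFP.id _).pair (urange.comp hcountU))).congr fun _ => by simp only [tableN]; rfl
  have hrangeL : CodeFP tblArgE (rawE natE) (fun a => List.range a.1.2.2.2.2.2.2) := (urange.comp (fst _ _).snd'.snd'.snd'.snd'.snd'.snd').congr fun _ => rfl
  exact ((CodeFP.map htable).comp ((CodeFP.id _).pair hrangeL)).congr fun _ => by simp only [tablesN, id]

/-- **The tables function** of the `AC⁰[p]` learner. [cite: CarmosinoImpagliazzoKabanetsKolokolova2016, §5 (step 2)] -/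
noncomputable def tablesPFn : List Bool → List Bool := Classical.choose tables_codeFP

/-- `tablesPFn ∈ FP`. [folklore] -/
theorem tablesPFn_mem_FP : tablesPFn ∈ FP := (Classical.choose_spec tables_codeFP).1

/-- **Value of `tablesPFn`**: the list code of the tables of the recipe. [folklore] -/
theorem tablesPFn_apply (a : TblArgT) :
    tablesPFn (tblArgE a) = OracleCompose.body (tablesN a.1.1 a.1.2.1 a.1.2.2.1 a.1.2.2.2.1 a.1.2.2.2.2.1 a.1.2.2.2.2.2.1 a.1.2.2.2.2.2.2 a.2.1 a.2.2.1 a.2.2.2) := by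
  have h := (Classical.choose_spec tables_codeFP).2 a
  unfold tablesPFn
  rw [h, body_eq_encList]
  simp [rawE, strE]

end Codes

end Modp

end Literature.Computability.Learning
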